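import Summits.Parity.GeneralizedHardyLittlewood.Theorems.PrimeLevelFamEdgeIdeaDeltasWucSigmaDefs
import HarnessLib

/-!
# Route `PrimeLevelFamEdge` — TYPED IDEA DELTAS, deck 19c: the KNOWN rung of the K-L24-2 ladder — pigeonhole on
# simple critical zeros (`SimpleCriticalProportion p ⇒ CritClosePair Λ` for `Λ > 1/p`, with a DENSITY form) (§6)

LANDING NOTE (typer ls-idea-typ-1 gen 3, cell ls-idea): the seat's `Sketch_Wuc24.lean` v1.3 sha16 22fa835e799af413 §6
(seat ls-idea-lens-24, `wuc` × CI-GAPS; typing offer T-L24-3; critic F b9 PASS «typable-and-proved») VERBATIM up to the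
namespace (`Literature.NumberTheory.LFunctions.Wuc24` → the deck namespace `.WucSigma`, continuing decks 19a/19b) and
this header; §6c (one radius currency for both ends of the ladder) is deck 19d.  The hypothesis shape
`SimpleCriticalProportion p` is a DEFINITION (never asserted); the printed input it abbreviates — a positive proportion
of SIMPLE critical zeros of `ζ`, `liminf N₀*(T)/N(T) ≥ .4075` (Pratt–Robles–Zaharescu–Zeindler 2019, arXiv:1802.10521
Thm 1.1, as quoted in arXiv:2010.10675 p. 4) — is NOT filed as a Literature fact by this deck (critic F P-F7-1: a
one-fact Literature decision, left to a literature seat); every theorem below that uses it takes it as a hypothesis.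

Typed ≠ proved: nothing here proves `X := ∃ c > 0, SubnormalGapsHypothesis c`, any rung `CritClosePair Λ` with
`Λ ≤ 2.454` unconditionally, the odd leaf, or any exceptional-zero statement.  No Riemann hypothesis anywhere.
-/

noncomputable section

namespace Summit.Parity.GeneralizedHardyLittlewood.Theorems.PrimeLevelFamEdgeIdeaDeltas.WucSigma

open _root_.Complex NumberField Literature.NumberTheory.LFunctions.NumberField
open Literature.NumberTheory.LFunctions Literature.NumberTheory.LFunctions.ConreyIwaniec2002

/-! ### §6 The KNOWN rung of the K-L24-2 ladder, typed: pigeonhole on simple critical zeros -/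

/-- HYPOTHESIS SHAPE (PARAMETRIC in the proportion `p`; a definition, nothing asserted here and NOT filed
as a Literature fact by this deck): simple critical zeros in proportion `p`, in the explicit form
`p · (T/2π) · log T ≤ #{0 < γ ≤ T : ζ(½+iγ) = 0, ζ′(½+iγ) ≠ 0}` for `T ≥ T₀`.  The seat reads the print
as giving this for every `p < 0.4075` (Pratt–Robles–Zaharescu–Zeindler 2019, arXiv:1802.10521 Thm 1.1,
`liminf N₀*(T)/N(T) ≥ .4075`, with Riemann–von Mangoldt `N(T) ~ (T/2π) log T`; quoted in arXiv:2010.10675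
p. 4) — that reading is an INPUT the theorems below take as the hypothesis `hF`. -/
def SimpleCriticalProportion (p : ℝ) : Prop :=
  ∃ T₀ : ℝ, ∀ T : ℝ, T₀ ≤ T →
    p * (T / (2 * Real.pi)) * Real.log T ≤
      ({γ : ℝ | 0 < γ ∧ γ ≤ T ∧ riemannZeta (1 / 2 + γ * I) = 0 ∧
        deriv riemannZeta (1 / 2 + γ * I) ≠ 0}.ncard : ℝ)

/-- Packing: a finite set of reals in `[a, b]` (`a ≤ b`) whose points are pairwise `≥ δ > 0` apart
has `card · δ ≤ b − a + δ`. -/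
theorem card_mul_le_of_separated (s : Finset ℝ) {a δ : ℝ} (hδ : 0 < δ) :
    ∀ b : ℝ, a ≤ b → (∀ x ∈ s, a ≤ x ∧ x ≤ b) → (∀ x ∈ s, ∀ y ∈ s, x < y → δ ≤ y - x) →
      (s.card : ℝ) * δ ≤ b - a + δ := by
  induction s using Finset.induction_on_max with
  | empty =>
    intro b hab _ _
    simp only [Finset.card_empty, Nat.cast_zero, zero_mul]
    linarith
  | insert m s hlt ih =>
    intro b hab hmem hsep
    have hm : a ≤ m ∧ m ≤ b := hmem m (Finset.mem_insert_self m s)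
    have hms : m ∉ s := fun h => lt_irrefl m (hlt m h)
    rw [Finset.card_insert_of_notMem hms]
    have e : (((s.card + 1 : ℕ) : ℝ)) * δ = (s.card : ℝ) * δ + δ := by push_cast; ring
    rw [e]
    rcases s.eq_empty_or_nonempty with hs | hs
    · subst hs
      simp only [Finset.card_empty, Nat.cast_zero, zero_mul]
      linarith [hm.1, hm.2]
    · have hle : ∀ x ∈ s, a ≤ x ∧ x ≤ m - δ := by
        intro x hx
        refine ⟨(hmem x (Finset.mem_insert_of_mem hx)).1, ?_⟩
        have := hsep x (Finset.mem_insert_of_mem hx) m (Finset.mem_insert_self m s) (hlt x hx)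
        linarith
      obtain ⟨x₀, hx₀⟩ := hs
      have hab' : a ≤ m - δ := (hle x₀ hx₀).1.trans (hle x₀ hx₀).2
      have hsep' : ∀ x ∈ s, ∀ y ∈ s, x < y → δ ≤ y - x := fun x hx y hy hxy =>
        hsep x (Finset.mem_insert_of_mem hx) y (Finset.mem_insert_of_mem hy) hxy
      have := ih (m - δ) hab' hle hsep'
      linarith [hm.2]

/-- **The known rung, typed (R-L24-1)**: a proportion `p > 0` of SIMPLE critical zeros gives, by
pigeonhole, two DISTINCT critical zeros within `Λ` mean spacings beyond every height, for every
`Λ > 1/p` (`p = 0.4075⁻ ⇒ Λ > 2.454`). Proved modulo the named-fact shape `SimpleCriticalProportion p`;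
no `L`-function content, no Riemann hypothesis. -/
theorem critClosePair_of_simpleCriticalProportion {p Λ : ℝ} (hp : 0 < p)
    (hF : SimpleCriticalProportion p) (hΛ : 1 / p < Λ) : CritClosePair Λ := by
  intro T₀'
  by_contra hno
  push Not at hno
  obtain ⟨T₀, hT₀⟩ := hF
  have hΛpos : 0 < Λ := lt_trans (div_pos one_pos hp) hΛ
  have h1 : 1 < Λ * p := (div_lt_iff₀ hp).1 hΛ
  have hgap : 0 < p - 1 / Λ := by
    have : 1 / Λ < p := (div_lt_iff₀ hΛpos).2 (by linarith [mul_comm Λ p])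
    linarith
  -- heights
  obtain ⟨T₁, hT₁⟩ : ∃ T₁ : ℝ, max T₀' 2 = T₁ := ⟨_, rfl⟩
  have hT₁a : T₀' ≤ T₁ := by rw [← hT₁]; exact le_max_left _ _
  have hT₁b : 2 ≤ T₁ := by rw [← hT₁]; exact le_max_right _ _
  obtain ⟨M, hM⟩ : ∃ M : ℕ,
      {γ : ℝ | 0 < γ ∧ γ ≤ T₁ ∧ riemannZeta (1 / 2 + γ * I) = 0}.ncard = M := ⟨_, rfl⟩
  obtain ⟨T, hT⟩ : ∃ T : ℝ,
      max (max T₀ T₁) (max 3 (2 * Real.pi * ((M : ℝ) + 2) / (p - 1 / Λ))) = T := ⟨_, rfl⟩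
  have hTT₀ : T₀ ≤ T := by rw [← hT]; exact le_trans (le_max_left _ _) (le_max_left _ _)
  have hTT₁ : T₁ ≤ T := by rw [← hT]; exact le_trans (le_max_right _ _) (le_max_left _ _)
  have hT3 : 3 ≤ T := by rw [← hT]; exact le_trans (le_max_left _ _) (le_max_right _ _)
  have hTbig : 2 * Real.pi * ((M : ℝ) + 2) / (p - 1 / Λ) ≤ T := by
    rw [← hT]; exact le_trans (le_max_right _ _) (le_max_right _ _)
  have hlogT1 : 1 ≤ Real.log T := by
    rw [← Real.log_exp 1]
    exact Real.log_le_log (Real.exp_pos 1) (by linarith [Real.exp_one_lt_d9])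
  have hlogTpos : 0 < Real.log T := by linarith
  have hπ : 0 < Real.pi := Real.pi_pos
  -- the count from the fact
  have hcount := hT₀ T hTT₀
  -- finiteness of the sets involved
  have hAfin : {γ : ℝ | 0 < γ ∧ γ ≤ T ∧ riemannZeta (1 / 2 + γ * I) = 0 ∧
      deriv riemannZeta (1 / 2 + γ * I) ≠ 0}.Finite :=
    (critOrdinates_finite T).subset fun γ ⟨h0, hT', hz, _⟩ => ⟨h0, hT', hz⟩
  have hSfin : {γ : ℝ | (0 < γ ∧ γ ≤ T ∧ riemannZeta (1 / 2 + γ * I) = 0 ∧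
      deriv riemannZeta (1 / 2 + γ * I) ≠ 0) ∧ T₁ ≤ γ}.Finite :=
    hAfin.subset fun γ hγ => hγ.1
  have hBfin : {γ : ℝ | (0 < γ ∧ γ ≤ T ∧ riemannZeta (1 / 2 + γ * I) = 0 ∧
      deriv riemannZeta (1 / 2 + γ * I) ≠ 0) ∧ γ < T₁}.Finite :=
    hAfin.subset fun γ hγ => hγ.1
  have hCfin := critOrdinates_finite T₁
  -- ncard A ≤ ncard S + ncard B
  have hAle : ({γ : ℝ | 0 < γ ∧ γ ≤ T ∧ riemannZeta (1 / 2 + γ * I) = 0 ∧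
      deriv riemannZeta (1 / 2 + γ * I) ≠ 0}.ncard : ℝ) ≤
      ({γ : ℝ | (0 < γ ∧ γ ≤ T ∧ riemannZeta (1 / 2 + γ * I) = 0 ∧
        deriv riemannZeta (1 / 2 + γ * I) ≠ 0) ∧ T₁ ≤ γ}.ncard : ℝ) +
      ({γ : ℝ | (0 < γ ∧ γ ≤ T ∧ riemannZeta (1 / 2 + γ * I) = 0 ∧
        deriv riemannZeta (1 / 2 + γ * I) ≠ 0) ∧ γ < T₁}.ncard : ℝ) := by
    have hsub : {γ : ℝ | 0 < γ ∧ γ ≤ T ∧ riemannZeta (1 / 2 + γ * I) = 0 ∧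
        deriv riemannZeta (1 / 2 + γ * I) ≠ 0} ⊆
        {γ : ℝ | (0 < γ ∧ γ ≤ T ∧ riemannZeta (1 / 2 + γ * I) = 0 ∧
          deriv riemannZeta (1 / 2 + γ * I) ≠ 0) ∧ T₁ ≤ γ} ∪
        {γ : ℝ | (0 < γ ∧ γ ≤ T ∧ riemannZeta (1 / 2 + γ * I) = 0 ∧
          deriv riemannZeta (1 / 2 + γ * I) ≠ 0) ∧ γ < T₁} := by
      intro γ hγ
      rcases le_or_gt T₁ γ with h | h
      · exact Or.inl ⟨hγ, h⟩
      · exact Or.inr ⟨hγ, h⟩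
    have := (Set.ncard_le_ncard hsub (hSfin.union hBfin)).trans (Set.ncard_union_le _ _)
    exact_mod_cast this
  -- ncard B ≤ M
  have hBle : ({γ : ℝ | (0 < γ ∧ γ ≤ T ∧ riemannZeta (1 / 2 + γ * I) = 0 ∧
        deriv riemannZeta (1 / 2 + γ * I) ≠ 0) ∧ γ < T₁}.ncard : ℝ) ≤ M := by
    rw [← hM]
    have hBC : {γ : ℝ | (0 < γ ∧ γ ≤ T ∧ riemannZeta (1 / 2 + γ * I) = 0 ∧
        deriv riemannZeta (1 / 2 + γ * I) ≠ 0) ∧ γ < T₁} ⊆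
        {γ : ℝ | 0 < γ ∧ γ ≤ T₁ ∧ riemannZeta (1 / 2 + γ * I) = 0} :=
      fun γ hγ => ⟨hγ.1.1, hγ.2.le, hγ.1.2.2.1⟩
    exact_mod_cast Set.ncard_le_ncard hBC hCfin
  -- separation of S (from `hno`) and the packing bound
  obtain ⟨δ, hδ⟩ : ∃ δ : ℝ, Λ * (2 * Real.pi / Real.log T) = δ := ⟨_, rfl⟩
  have hδpos : 0 < δ := by rw [← hδ]; positivity
  have hSle : ({γ : ℝ | (0 < γ ∧ γ ≤ T ∧ riemannZeta (1 / 2 + γ * I) = 0 ∧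
        deriv riemannZeta (1 / 2 + γ * I) ≠ 0) ∧ T₁ ≤ γ}.ncard : ℝ) * δ ≤ T - T₁ + δ := by
    rw [Set.ncard_eq_toFinset_card _ hSfin]
    refine card_mul_le_of_separated hSfin.toFinset hδpos T hTT₁ ?_ ?_
    · intro x hx
      rw [Set.Finite.mem_toFinset] at hx
      exact ⟨hx.2, hx.1.2.1⟩
    · intro x hx y hy hxy
      rw [Set.Finite.mem_toFinset] at hx hy
      have hx2 : 2 ≤ x := hT₁b.trans hx.2
      have hsepxy := hno x y (hT₁a.trans hx.2) hx2 (ne_of_gt hxy) hx.1.2.2.1 hy.1.2.2.1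
      have hlogx : 0 < Real.log x := Real.log_pos (by linarith)
      have hlogxT : Real.log x ≤ Real.log T := Real.log_le_log (by linarith) hx.1.2.1
      have hδx : δ ≤ Λ * (2 * Real.pi / Real.log x) := by
        rw [← hδ]
        apply mul_le_mul_of_nonneg_left _ hΛpos.le
        exact div_le_div_of_nonneg_left (by positivity) hlogx hlogxT
      have habs : |x - y| = y - x := by rw [abs_sub_comm]; exact abs_of_pos (by linarith)
      rw [habs] at hsepxy
      linarith
  have hS' : ({γ : ℝ | (0 < γ ∧ γ ≤ T ∧ riemannZeta (1 / 2 + γ * I) = 0 ∧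
        deriv riemannZeta (1 / 2 + γ * I) ≠ 0) ∧ T₁ ≤ γ}.ncard : ℝ) ≤ T / δ + 1 := by
    have hT₁0 : 0 ≤ T₁ := by linarith
    have h' : ({γ : ℝ | (0 < γ ∧ γ ≤ T ∧ riemannZeta (1 / 2 + γ * I) = 0 ∧
        deriv riemannZeta (1 / 2 + γ * I) ≠ 0) ∧ T₁ ≤ γ}.ncard : ℝ) ≤ (T + δ) / δ := by
      rw [le_div_iff₀ hδpos]; linarith
    rwa [add_div, div_self hδpos.ne'] at h'
  -- `T/δ = (1/Λ) · (T/2π) · log T`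
  have hTδ : T / δ = (1 / Λ) * (T / (2 * Real.pi)) * Real.log T := by
    rw [← hδ]; field_simp
  have hmain : p * (T / (2 * Real.pi)) * Real.log T ≤
      (1 / Λ) * (T / (2 * Real.pi)) * Real.log T + 1 + M := by
    calc p * (T / (2 * Real.pi)) * Real.log T ≤ _ := hcount
      _ ≤ _ := hAle
      _ ≤ (T / δ + 1) + M := add_le_add hS' hBle
      _ = _ := by rw [hTδ]
  -- contradiction with the size of `T`
  have hX : (M : ℝ) + 2 ≤ (p - 1 / Λ) * (T / (2 * Real.pi)) := by
    have h' := hTbig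
    rw [div_le_iff₀ hgap] at h'
    rw [show (p - 1 / Λ) * (T / (2 * Real.pi)) = T * (p - 1 / Λ) / (2 * Real.pi) by ring,
      le_div_iff₀ (by positivity)]
    linarith
  have hY : (p - 1 / Λ) * (T / (2 * Real.pi)) ≤ (p - 1 / Λ) * (T / (2 * Real.pi)) * Real.log T := by
    have h0 : 0 ≤ (p - 1 / Λ) * (T / (2 * Real.pi)) := mul_nonneg hgap.le (by positivity)
    calc (p - 1 / Λ) * (T / (2 * Real.pi)) = (p - 1 / Λ) * (T / (2 * Real.pi)) * 1 := by ring
      _ ≤ _ := mul_le_mul_of_nonneg_left hlogT1 h0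
  have hZ : (p - 1 / Λ) * (T / (2 * Real.pi)) * Real.log T ≤ 1 + M := by
    have e : (p - 1 / Λ) * (T / (2 * Real.pi)) * Real.log T =
        p * (T / (2 * Real.pi)) * Real.log T - (1 / Λ) * (T / (2 * Real.pi)) * Real.log T := by
      ring
    rw [e]; linarith
  linarith

/-- The rung of record: with `p = 0.4075⁻` (PRZZ), every `Λ > 1/0.4075 = 2.4539…` is reached; stated
for `Λ ≥ 5/2` from any proportion `p > 2/5`. -/
theorem critClosePair_of_twoFifths {p Λ : ℝ} (hp : 2 / 5 < p) (hF : SimpleCriticalProportion p)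
    (hΛ : 5 / 2 ≤ Λ) : CritClosePair Λ :=
  critClosePair_of_simpleCriticalProportion (by linarith) hF
    (lt_of_lt_of_le (by rw [div_lt_iff₀ (by linarith)]; nlinarith) hΛ)

/-- The K-L24-2 ladder in X's own currency: critical zeros `0 < γ ≤ T` having a DISTINCT critical
zero within `Λ` mean spacings, T-uniform radius `2πΛ/log T` (which implies the per-zero radius
`2πΛ/log γ` for `γ ≤ T`). X asks `≫ T (log T)^{4/5}` such zeros at `Λ ↑ ½` (modulo the multiplicity
channel); unconditionally a FULL density `≫ T log T` is known exactly for `Λ > 1/0.4075 = 2.454`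
(`critClosePairSet_density` below, modulo the named-fact shape). -/
def critClosePairSet (Λ T : ℝ) : Set ℝ :=
  {γ : ℝ | 0 < γ ∧ γ ≤ T ∧ riemannZeta (1 / 2 + γ * I) = 0 ∧
    ∃ γ' : ℝ, γ' ≠ γ ∧ riemannZeta (1 / 2 + γ' * I) = 0 ∧
      |γ - γ'| ≤ Λ * (2 * Real.pi / Real.log T)}

/-- The close-pair set below height `T` is finite. -/
theorem critClosePairSet_finite (Λ T : ℝ) : (critClosePairSet Λ T).Finite :=
  (critOrdinates_finite T).subset fun _ hγ => ⟨hγ.1, hγ.2.1, hγ.2.2.1⟩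

/-- **Density rung (R-L24-1 in X's currency, typed)**: a proportion `p` of simple critical zeros
forces at least `((p − 1/Λ)/2) · (T/2π) log T` critical zeros up to height `T` to have a DISTINCT
critical zero within `Λ` mean spacings, for every `Λ > 1/p` and all large `T` — the bad zeros are
`2πΛ/log T`-separated, so there are at most `(1/Λ)(T/2π) log T + 1` of them. Modulo the named-fact
shape only; no Riemann hypothesis. -/
theorem critClosePairSet_density {p Λ : ℝ} (hp : 0 < p) (hF : SimpleCriticalProportion p)
    (hΛ : 1 / p < Λ) :
    ∃ T₀ : ℝ, ∀ T : ℝ, T₀ ≤ T →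
      (p - 1 / Λ) / 2 * (T / (2 * Real.pi)) * Real.log T ≤ ((critClosePairSet Λ T).ncard : ℝ) := by
  obtain ⟨T₀, hT₀⟩ := hF
  have hΛpos : 0 < Λ := lt_trans (div_pos one_pos hp) hΛ
  have h1 : 1 < Λ * p := (div_lt_iff₀ hp).1 hΛ
  have hgap : 0 < p - 1 / Λ := by
    have : 1 / Λ < p := (div_lt_iff₀ hΛpos).2 (by linarith [mul_comm Λ p])
    linarith
  have hπ : 0 < Real.pi := Real.pi_pos
  refine ⟨max T₀ (max 3 (4 * Real.pi / (p - 1 / Λ))), fun T hT => ?_⟩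
  have hTT₀ : T₀ ≤ T := le_trans (le_max_left _ _) hT
  have hT3 : 3 ≤ T := le_trans (le_trans (le_max_left _ _) (le_max_right _ _)) hT
  have hTbig : 4 * Real.pi / (p - 1 / Λ) ≤ T :=
    le_trans (le_trans (le_max_right _ _) (le_max_right _ _)) hT
  have hlogT1 : 1 ≤ Real.log T := by
    rw [← Real.log_exp 1]
    exact Real.log_le_log (Real.exp_pos 1) (by linarith [Real.exp_one_lt_d9])
  have hlogTpos : 0 < Real.log T := by linarith
  have hcount := hT₀ T hTT₀
  obtain ⟨δ, hδ⟩ : ∃ δ : ℝ, Λ * (2 * Real.pi / Real.log T) = δ := ⟨_, rfl⟩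
  have hδpos : 0 < δ := by rw [← hδ]; positivity
  -- A = simple critical ordinates in (0,T], split as Good ∪ Bad by «a distinct critical zero within δ»
  have hAfin : {γ : ℝ | 0 < γ ∧ γ ≤ T ∧ riemannZeta (1 / 2 + γ * I) = 0 ∧
      deriv riemannZeta (1 / 2 + γ * I) ≠ 0}.Finite :=
    (critOrdinates_finite T).subset fun γ ⟨h0, hT', hz, _⟩ => ⟨h0, hT', hz⟩
  have hGfin : {γ : ℝ | (0 < γ ∧ γ ≤ T ∧ riemannZeta (1 / 2 + γ * I) = 0 ∧
      deriv riemannZeta (1 / 2 + γ * I) ≠ 0) ∧ ∃ γ' : ℝ, γ' ≠ γ ∧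
        riemannZeta (1 / 2 + γ' * I) = 0 ∧ |γ - γ'| ≤ δ}.Finite :=
    hAfin.subset fun γ hγ => hγ.1
  have hBfin : {γ : ℝ | (0 < γ ∧ γ ≤ T ∧ riemannZeta (1 / 2 + γ * I) = 0 ∧
      deriv riemannZeta (1 / 2 + γ * I) ≠ 0) ∧ ∀ γ' : ℝ, γ' ≠ γ →
        riemannZeta (1 / 2 + γ' * I) = 0 → δ < |γ - γ'|}.Finite :=
    hAfin.subset fun γ hγ => hγ.1
  have hAle : ({γ : ℝ | 0 < γ ∧ γ ≤ T ∧ riemannZeta (1 / 2 + γ * I) = 0 ∧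
      deriv riemannZeta (1 / 2 + γ * I) ≠ 0}.ncard : ℝ) ≤
      ({γ : ℝ | (0 < γ ∧ γ ≤ T ∧ riemannZeta (1 / 2 + γ * I) = 0 ∧
        deriv riemannZeta (1 / 2 + γ * I) ≠ 0) ∧ ∃ γ' : ℝ, γ' ≠ γ ∧
          riemannZeta (1 / 2 + γ' * I) = 0 ∧ |γ - γ'| ≤ δ}.ncard : ℝ) +
      ({γ : ℝ | (0 < γ ∧ γ ≤ T ∧ riemannZeta (1 / 2 + γ * I) = 0 ∧
        deriv riemannZeta (1 / 2 + γ * I) ≠ 0) ∧ ∀ γ' : ℝ, γ' ≠ γ →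
          riemannZeta (1 / 2 + γ' * I) = 0 → δ < |γ - γ'|}.ncard : ℝ) := by
    have hsub : {γ : ℝ | 0 < γ ∧ γ ≤ T ∧ riemannZeta (1 / 2 + γ * I) = 0 ∧
        deriv riemannZeta (1 / 2 + γ * I) ≠ 0} ⊆
        {γ : ℝ | (0 < γ ∧ γ ≤ T ∧ riemannZeta (1 / 2 + γ * I) = 0 ∧
          deriv riemannZeta (1 / 2 + γ * I) ≠ 0) ∧ ∃ γ' : ℝ, γ' ≠ γ ∧
            riemannZeta (1 / 2 + γ' * I) = 0 ∧ |γ - γ'| ≤ δ} ∪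
        {γ : ℝ | (0 < γ ∧ γ ≤ T ∧ riemannZeta (1 / 2 + γ * I) = 0 ∧
          deriv riemannZeta (1 / 2 + γ * I) ≠ 0) ∧ ∀ γ' : ℝ, γ' ≠ γ →
            riemannZeta (1 / 2 + γ' * I) = 0 → δ < |γ - γ'|} := by
      intro γ hγ
      by_cases h : ∃ γ' : ℝ, γ' ≠ γ ∧ riemannZeta (1 / 2 + γ' * I) = 0 ∧ |γ - γ'| ≤ δ
      · exact Or.inl ⟨hγ, h⟩
      · refine Or.inr ⟨hγ, fun γ' hne hz => ?_⟩
        by_contra hle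
        exact h ⟨γ', hne, hz, not_lt.1 hle⟩
    have := (Set.ncard_le_ncard hsub (hGfin.union hBfin)).trans (Set.ncard_union_le _ _)
    exact_mod_cast this
  -- Good ⊆ critClosePairSet Λ T (drop simplicity)
  have hGle : ({γ : ℝ | (0 < γ ∧ γ ≤ T ∧ riemannZeta (1 / 2 + γ * I) = 0 ∧
        deriv riemannZeta (1 / 2 + γ * I) ≠ 0) ∧ ∃ γ' : ℝ, γ' ≠ γ ∧
          riemannZeta (1 / 2 + γ' * I) = 0 ∧ |γ - γ'| ≤ δ}.ncard : ℝ) ≤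
      ((critClosePairSet Λ T).ncard : ℝ) := by
    have hsub : {γ : ℝ | (0 < γ ∧ γ ≤ T ∧ riemannZeta (1 / 2 + γ * I) = 0 ∧
        deriv riemannZeta (1 / 2 + γ * I) ≠ 0) ∧ ∃ γ' : ℝ, γ' ≠ γ ∧
          riemannZeta (1 / 2 + γ' * I) = 0 ∧ |γ - γ'| ≤ δ} ⊆ critClosePairSet Λ T := by
      rintro γ ⟨⟨h0, hT', hz, -⟩, γ', hne, hz', hle⟩
      exact ⟨h0, hT', hz, γ', hne, hz', by rw [hδ]; exact hle⟩
    exact_mod_cast Set.ncard_le_ncard hsub (critClosePairSet_finite Λ T)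
  -- Bad is δ-separated inside [0, T]
  have hBle : ({γ : ℝ | (0 < γ ∧ γ ≤ T ∧ riemannZeta (1 / 2 + γ * I) = 0 ∧
        deriv riemannZeta (1 / 2 + γ * I) ≠ 0) ∧ ∀ γ' : ℝ, γ' ≠ γ →
          riemannZeta (1 / 2 + γ' * I) = 0 → δ < |γ - γ'|}.ncard : ℝ) ≤ T / δ + 1 := by
    have hmul : ({γ : ℝ | (0 < γ ∧ γ ≤ T ∧ riemannZeta (1 / 2 + γ * I) = 0 ∧
        deriv riemannZeta (1 / 2 + γ * I) ≠ 0) ∧ ∀ γ' : ℝ, γ' ≠ γ →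
          riemannZeta (1 / 2 + γ' * I) = 0 → δ < |γ - γ'|}.ncard : ℝ) * δ ≤ T - 0 + δ := by
      rw [Set.ncard_eq_toFinset_card _ hBfin]
      refine card_mul_le_of_separated hBfin.toFinset hδpos T (by linarith) ?_ ?_
      · intro x hx
        rw [Set.Finite.mem_toFinset] at hx
        exact ⟨hx.1.1.le, hx.1.2.1⟩
      · intro x hx y hy hxy
        rw [Set.Finite.mem_toFinset] at hx hy
        have hsep := hx.2 y (ne_of_gt hxy) hy.1.2.2.1
        have habs : |x - y| = y - x := by rw [abs_sub_comm]; exact abs_of_pos (by linarith)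
        rw [habs] at hsep
        linarith
    have h' : ({γ : ℝ | (0 < γ ∧ γ ≤ T ∧ riemannZeta (1 / 2 + γ * I) = 0 ∧
        deriv riemannZeta (1 / 2 + γ * I) ≠ 0) ∧ ∀ γ' : ℝ, γ' ≠ γ →
          riemannZeta (1 / 2 + γ' * I) = 0 → δ < |γ - γ'|}.ncard : ℝ) ≤ (T + δ) / δ := by
      rw [le_div_iff₀ hδpos]; linarith
    rwa [add_div, div_self hδpos.ne'] at h'
  have hTδ : T / δ = (1 / Λ) * (T / (2 * Real.pi)) * Real.log T := by
    rw [← hδ]; field_simp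
  have hmain : p * (T / (2 * Real.pi)) * Real.log T ≤
      ((critClosePairSet Λ T).ncard : ℝ) + ((1 / Λ) * (T / (2 * Real.pi)) * Real.log T + 1) := by
    calc p * (T / (2 * Real.pi)) * Real.log T ≤ _ := hcount
      _ ≤ _ := hAle
      _ ≤ ((critClosePairSet Λ T).ncard : ℝ) + (T / δ + 1) := add_le_add hGle hBle
      _ = _ := by rw [hTδ]
  -- `1 ≤ (p − 1/Λ)/2 · (T/2π) log T` from the size of `T`
  have hX1 : 1 ≤ (p - 1 / Λ) / 2 * (T / (2 * Real.pi)) * Real.log T := by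
    have h' := hTbig
    rw [div_le_iff₀ hgap] at h'
    have h0 : 0 ≤ (p - 1 / Λ) / 2 * (T / (2 * Real.pi)) := mul_nonneg (by linarith) (by positivity)
    calc (1 : ℝ) ≤ (p - 1 / Λ) / 2 * (T / (2 * Real.pi)) := by
          rw [show (p - 1 / Λ) / 2 * (T / (2 * Real.pi)) = T * (p - 1 / Λ) / (4 * Real.pi) by ring,
            le_div_iff₀ (by positivity)]
          linarith
      _ = (p - 1 / Λ) / 2 * (T / (2 * Real.pi)) * 1 := by ring
      _ ≤ _ := mul_le_mul_of_nonneg_left hlogT1 h0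
  have e : (p - 1 / Λ) / 2 * (T / (2 * Real.pi)) * Real.log T =
      (p * (T / (2 * Real.pi)) * Real.log T - (1 / Λ) * (T / (2 * Real.pi)) * Real.log T) -
        (p - 1 / Λ) / 2 * (T / (2 * Real.pi)) * Real.log T := by ring
  linarith


end Summit.Parity.GeneralizedHardyLittlewood.Theorems.PrimeLevelFamEdgeIdeaDeltas.WucSigma

end
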